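import Summits.FinalStateConjecture.FinalStateConjecture.Theses.StarvedNecks
import Literature.Geometry.Lorentzian.MinkowskiCauchyDevelopment
import Literature.Geometry.Lorentzian.CauchyDevelopmentRestrict
import Literature.Geometry.Lorentzian.DataEmbeddingNormalSmooth
import Literature.Geometry.Lorentzian.OpensCausality

/-!
# `HonestFixedRadiusSettling` (crux `stmt-FinalStateConjecture-13550`, route `StarvedNecks`):
# the time-truncated Minkowski development (negative-side support, part 1 of 2)

Support file of the crux disprover (cdisprove seat, generation 2). The crux asserts
Christodoulou-genericity of `P D := (∃ MGHD) ∧ ∀ 𝒟 : VacuumCauchyDevelopment D, 𝒟.IsMaximal →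
(complete 𝓘⁺ ∧ honest C⁴ decomposition)`. To show that the guard `𝒟.IsMaximal →` is load-bearing
(part 2, `MaximalityLoadBearing.lean`) we CONSTRUCT here — no named facts, no `sorry`, axioms
`propext · Classical.choice · Quot.sound` — a non-maximal vacuum Cauchy development of the trivial
data `(ℝ³, δ, 0)`:

* `TruncatedMinkowski.slab T` — the open slab `{x⁰ < T}` of Minkowski spacetime (convex, hence
  connected: `isConnected_slab`), containing the data hypersurface `{x⁰ = 0}` when `0 < T`;
* `TruncatedMinkowski.isCauchyHypersurface_slab` — `{x⁰ = 0}` is a Cauchy hypersurface of the slab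
  with the restricted metric and time orientation: along an endless timelike curve of the slab the
  time coordinate is continuous, strictly increasing (`Minkowski.strictMonoOn_time`), unbounded
  below (a past endpoint in `E4` would have time `< T`, i.e. lie in the slab) and takes positive
  values (else it is bounded above and the curve has a future endpoint in `E4` of time `≤ 0 < T`,
  again in the slab) — conclude by the intermediate value theorem (O'Neill 1983, Def. 14.28 and
  the remark following it);
* `TruncatedMinkowski.development T hT : VacuumCauchyDevelopment trivialData` — the slab as a vacuum
  Cauchy development of the trivial data (`VacuumCauchyDevelopment.restrict`, Sbierski 2016,
  Def. 2.4: sub-developments `U ⊆ M`; the smoothness of the normal along the slice is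
  `DataEmbedding.mdifferentiableAt_embed_normal`).

Part 2 shows that this development has INCOMPLETE future null infinity in the sojourn sense.

References: J. Sbierski, Ann. Henri Poincaré 17 (2016) 301–329, Def. 2.4; B. O'Neill,
*Semi-Riemannian geometry*, 1983, Ch. 14, Def. 14.28; S. W. Hawking, G. F. R. Ellis, 1973, §6.2
(endpoints) and §6.5 (Cauchy developments).
-/

noncomputable section

set_option linter.dupNamespace false

open Literature.Geometry.Lorentzian
open scoped Manifold ContDiff ENNReal Topology
open Filter Set Bundle TopologicalSpace MeasureTheory

namespace Summit.FinalStateConjecture.FinalStateConjecture.Theorems.HonestFixedRadiusSettling.Negative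

namespace TruncatedMinkowski

open Minkowski

/-- Minkowski spacetime as the vacuum Cauchy development of the trivial data (tree). -/
abbrev 𝒟₀ : VacuumCauchyDevelopment trivialData := Minkowski.vacuumCauchyDevelopment

/-- The open slab `{x⁰ < T}` of Minkowski spacetime. -/
def slab (T : ℝ) : Opens 𝒟₀.carrier :=
  ⟨{x : E4 | x 0 < T}, isOpen_lt (PiLp.continuous_apply 2 _ 0) continuous_const⟩

/-- Membership in the slab. -/
theorem mem_slab_iff {T : ℝ} {x : E4} : (x : 𝒟₀.carrier) ∈ slab T ↔ x 0 < T := Iff.rfl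

/-- The slab is convex, hence connected. -/
theorem isConnected_slab (T : ℝ) : IsConnected ((slab T : Opens 𝒟₀.carrier) : Set 𝒟₀.carrier) := by
  have hconv : Convex ℝ {x : E4 | x 0 < T} := by
    have h := convex_halfSpace_lt (EuclideanSpace.proj (0 : Fin 4) : E4 →L[ℝ] ℝ).toLinearMap.isLinear T
    exact h
  have hne : ({x : E4 | x 0 < T} : Set E4).Nonempty := by
    refine ⟨E4.ofTimeSpace (T - 1) 0, ?_⟩
    show E4.ofTimeSpace (T - 1) 0 0 < T
    rw [E4.ofTimeSpace_apply_zero]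
    linarith
  exact ⟨hne, hconv.isPreconnected⟩

/-- The data hypersurface `{x⁰ = 0}` lies in the slab when `0 < T`. -/
theorem embed_mem_slab {T : ℝ} (hT : 0 < T) (y : Minkowski.slice) : 𝒟₀.embed y ∈ slab T := by
  show E4.ofTimeSpace 0 (y : E3) 0 < T
  rw [E4.ofTimeSpace_apply_zero]
  exact hT


/-- The restricted metric of the slab. -/
abbrev slabMetric (T : ℝ) :=
  𝒟₀.metric.restrict PseudoRiemannianMetric.contMDiff_restrict_holds (slab T)

/-- The restricted time orientation of the slab. -/
abbrev slabTimeOrientation (T : ℝ) : TimeOrientation (slabMetric T) :=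
  𝒟₀.timeOrientation.restrict PseudoRiemannianMetric.contMDiff_restrict_holds
    𝒟₀.timeOrientation.contMDiff_restrict_holds (slab T)

/-- A point of the slab is on the data hypersurface iff its time coordinate vanishes. -/
theorem mem_range_embedOpens_iff {T : ℝ} (hT : 0 < T) (z : slab T) :
    z ∈ range (𝒟₀.embedOpens (slab T) (embed_mem_slab hT)) ↔ (show E4 from z.1) 0 = 0 := by
  rw [← E4.mem_range_sliceEmbed_iff]
  constructor
  · rintro ⟨y, rfl⟩
    exact ⟨y, rfl⟩
  · rintro ⟨y, hy⟩
    exact ⟨y, Subtype.ext hy⟩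

/-- **`{x⁰ = 0}` is a Cauchy hypersurface of the slab `{x⁰ < T}`** (`0 < T`): along an endless
timelike curve of the slab the time coordinate is continuous, strictly increasing and `< T`; it is
unbounded below (a past endpoint in `E4` would lie in the slab), and it takes positive values (else
it is bounded above, the curve has a future endpoint in `E4` with `x⁰ ≤ 0 < T`, i.e. in the slab);
conclude by the intermediate value theorem. O'Neill 1983, Ch. 14, Def. 14.28. -/
theorem isCauchyHypersurface_slab {T : ℝ} (hT : 0 < T) :
    (slabMetric T).IsCauchyHypersurface (slabTimeOrientation T)
      (range (𝒟₀.embedOpens (slab T) (embed_mem_slab hT))) := by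
  intro γ s hγ
  obtain ⟨hs, hcurve, hfut, hpast⟩ := hγ
  set β : ℝ → E4 := Subtype.val ∘ γ with hβ_def
  have hβ : spacetime.metric.IsFutureTimelikeCurveOn spacetime.timeOrientation β s :=
    (LorentzianMetric.isFutureTimelikeCurveOn_restrict_iff _ _ _ _ _).1 hcurve
  have hmono := strictMonoOn_time hs hβ
  have hcont := continuousOn_time hβ
  have hltT : ∀ σ ∈ s, β σ 0 < T := fun σ _ ↦ (γ σ).2
  have hsne : s.Nonempty := hfut.1
  obtain ⟨σ₀, hσ₀⟩ := hsne
  haveI : Nonempty s := ⟨⟨σ₀, hσ₀⟩⟩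
  -- continuity of the time coordinate `E4 → ℝ`
  have hc0 : Continuous fun x : E4 ↦ x 0 := PiLp.continuous_apply 2 _ 0
  -- an endpoint of `β` in `E4` has time coordinate `≤ β σ₀ 0 < T` (past) resp. `≤ 0` (future)
  -- PAST: `β` is past endless in `E4`
  have hpastE4 : IsPastEndless β s := by
    refine ⟨⟨σ₀, hσ₀⟩, fun p hp ↦ ?_⟩
    have h0 : Tendsto (fun t : s ↦ β t 0) atBot (𝓝 (p 0)) := (hc0.tendsto p).comp hp
    have hev : ∀ᶠ t : s in atBot, β t 0 ≤ β σ₀ 0 := by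
      filter_upwards [eventually_le_atBot (⟨σ₀, hσ₀⟩ : s)] with t ht
      exact hmono.monotoneOn t.2 hσ₀ ht
    have hp0 : p 0 ≤ β σ₀ 0 := le_of_tendsto h0 hev
    have hpU : (p : 𝒟₀.carrier) ∈ slab T := lt_of_le_of_lt hp0 (hltT σ₀ hσ₀)
    exact hpast.2 ⟨p, hpU⟩ (hasPastEndpoint_subtypeVal_comp_iff.1 hp)
  obtain ⟨a, ha, ha0⟩ : ∃ a ∈ s, β a 0 < 0 := by
    have := not_bddBelow_iff.mp (not_bddBelow_time hs hβ hpastE4) 0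
    obtain ⟨_, ⟨a, ha, rfl⟩, hlt⟩ := this
    exact ⟨a, ha, hlt⟩
  -- FUTURE: some value of the time coordinate is positive
  obtain ⟨b, hb, hb0⟩ : ∃ b ∈ s, 0 < β b 0 := by
    by_contra hcon
    push Not at hcon
    have hbdd : BddAbove ((fun σ ↦ β σ 0) '' s) := ⟨0, by rintro _ ⟨σ, hσ, rfl⟩; exact hcon σ hσ⟩
    have hnot : ¬ IsFutureEndless β s := fun h ↦ not_bddAbove_time hs hβ h hbdd
    simp only [IsFutureEndless, not_and, not_forall, not_not] at hnot
    obtain ⟨p, hp⟩ := hnot ⟨σ₀, hσ₀⟩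
    have h0 : Tendsto (fun t : s ↦ β t 0) atTop (𝓝 (p 0)) := (hc0.tendsto p).comp hp
    have hev : ∀ᶠ t : s in atTop, β t 0 ≤ 0 := Eventually.of_forall fun t ↦ hcon t t.2
    have hp0 : p 0 ≤ 0 := le_of_tendsto h0 hev
    have hpU : (p : 𝒟₀.carrier) ∈ slab T := lt_of_le_of_lt hp0 hT
    exact hfut.2 ⟨p, hpU⟩ (hasFutureEndpoint_subtypeVal_comp_iff.1 hp)
  obtain ⟨σ, hσ, hσ0⟩ : ∃ σ ∈ s, β σ 0 = 0 :=
    hs.isPreconnected.intermediate_value ha hb hcont ⟨ha0.le, hb0.le⟩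
  refine ⟨σ, ⟨hσ, (mem_range_embedOpens_iff hT _).2 hσ0⟩, ?_⟩
  rintro t ⟨ht, htS⟩
  have ht0 := (mem_range_embedOpens_iff hT _).1 htS
  exact hmono.injOn ht hσ (ht0.trans hσ0.symm)

/-- **The time-truncated Minkowski development**: the slab `{x⁰ < T}` (`0 < T`) with the
restricted metric and time orientation, the slice embedding `y ↦ (0, y)` and normal `∂ₜ`, is a
vacuum Cauchy development of the trivial data `(ℝ³, δ, 0)` (`VacuumCauchyDevelopment.restrict`). -/
def development (T : ℝ) (hT : 0 < T) : VacuumCauchyDevelopment trivialData :=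
  𝒟₀.restrict (slab T) (isConnected_slab T) (embed_mem_slab hT)
    (𝒟₀.toDataEmbedding.mdifferentiableAt_embed_normal) (isCauchyHypersurface_slab hT)

end TruncatedMinkowski

end Summit.FinalStateConjecture.FinalStateConjecture.Theorems.HonestFixedRadiusSettling.Negative

end
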